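import Summits.CriticalPhenomena.Ising3DConformalLimit.Theorems.PlantedPinningGaussianPinningSaturationDefs
import Summits.CriticalPhenomena.Ising3DConformalLimit.Theorems.PlantedPinningPinningEfficiencyLeOnePinningLemma

/-!
# The linear Riccati flow `v_j = linVar L j` is positive and non-increasing
(stub `stub_linVarAntitone` of line `birth`, crux `GaussianPinningSaturation`,
item stmt-CriticalPhenomena-8452; objects in `…GaussianPinningSaturationDefs`)

Informal statement. For the critical `+`-boundary Ising box `Λ_L = box 3 L` on `ℤ³`
(`β = β_c(3)`, `h = 0`), `n = |Λ_L|`, let `v_j = linVar L j = (n choose j)⁻¹ Σ_{|P| = j} R_L(P)`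
be the average over uniform `j`-subsets `P ⊆ Λ_L` of the Schur-complement (linear) residual
`R_L(P) = linResidual L P = Var⁺(M_L) − cᵀ (G_{PP})⁻¹ c` (`c_a = Cov⁺(M_L, σ_a)`, `G_{PP}` the
covariance matrix of the pinned spins). Then for every `j < n`: `0 < v_j` and `v_{j+1} ≤ v_j`
(`stub_linVarAntitone`, registered signature verbatim). These are the two facts any Riccati
manipulation `1/v_{j+1} − 1/v_j` of the flow of the open leaf B2 (`LinRiccatiSaturation`) uses;
the flow itself is the one of the pinning lemma (Montanari 2008, arXiv:0709.0145;
Raghavendra–Tan, SODA 2012, Lemma 4.3) for the Gaussian vector with the Ising covariance.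

Proof (finite sums; abstract part for centred observables `t_x`, positive weights `w`,
`G(x,y) = Σ w t_x t_y`, copied from the landed sibling `…LinEffLeOne`). (1) `G_{PP}` is
nonsingular for `P ⊆ Λ` (one-site flip, `isUnit_det_covP`). (2) Least squares (folklore): the
residual `R_P = M − β*·t_P`, `β* = G_{PP}⁻¹ c_P`, satisfies the normal equations and
`Σ w R_P² = R_L(P)` (`residual`), whence `0 ≤ R_L(Q) ≤ Σ w (M − γ·t_Q)²` for every `γ`
(`residual_le`). (3) MONOTONICITY: for `z ∈ Λ ∖ P`, testing `R_L(P ∪ {z})` with `γ = β*` extended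
by `γ_z = 0` gives `R_L(P ∪ {z}) ≤ Σ w R_P² = R_L(P)` (`residual_insert_le`); double counting
`Σ_{|P|=j} Σ_{z ∉ P} R_L(P ∪ {z}) = (j+1) Σ_{|Q|=j+1} R_L(Q)` (`sum_powersetCard_sum_sdiff_insert`)
and Pascal's rule `(j+1)·C(n,j+1) = (n−j)·C(n,j)` give `v_{j+1} ≤ v_j`. (4) POSITIVITY: for
`z ∈ Λ ∖ P` the two patterns of the one-site flip at `z` are told apart by `R_P`
(`R_P ω − R_P ω' = t_z ω − t_z ω' ≠ 0`), so `R_P ≢ 0` and `R_L(P) = Σ w R_P² > 0` (all `w > 0`,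
`residual_pos`); every `j`-subset with `j < n` misses a site, so `v_j > 0` (`flow_pos_antitone`).
(5) Ising case exactly as in `stub_linEffLeOne`: plus expectations are `w`-sums
(`integral_isingMeasure`), `t_x = σ_x − ⟨σ_x⟩⁺`, `G = cov L`, one spin flip of the all-plus
pattern realises the flip hypothesis; all bridges are `rfl`. References: Montanari 2008
(arXiv:0709.0145); Raghavendra–Tan 2012, Lemma 4.3; El Alaoui–Montanari 2021, eqs. (1.4)–(1.6);
normal equations of least squares (folklore).
-/

noncomputable section

namespace Summit.CriticalPhenomena.Ising3DConformalLimit.PlantedPinningGaussianPinningSaturation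

open scoped BigOperators Classical
open Finset MeasureTheory Matrix
open Literature.Probability.LatticeModels
open Summit.CriticalPhenomena.Ising3DConformalLimit.Theses.PlantedPinning
open Summit.CriticalPhenomena.Ising3DConformalLimit.PlantedPinningCeiling

/-! ### Least squares for a finite weighted family of centred observables -/

section Abstract

variable {V Ω : Type*} [DecidableEq V] [Fintype Ω]

/-- Pure algebra: a weighted moment against a linear combination of observables is the
corresponding combination of moments. [folklore] -/
private theorem wsum_mul_lin {ι : Type*} (w g : Ω → ℝ) (Q : Finset ι) (γ : ι → ℝ)
    (u : ι → Ω → ℝ) :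
    ∑ ω, w ω * g ω * (∑ x ∈ Q, γ x * u x ω) = ∑ x ∈ Q, γ x * ∑ ω, w ω * g ω * u x ω := by
  simp only [Finset.mul_sum]
  rw [Finset.sum_comm]
  exact Finset.sum_congr rfl fun x _ => Finset.sum_congr rfl fun ω _ => by ring

/-- Pure algebra: a weighted moment against a sum of observables. [folklore] -/
private theorem wsum_mul_sum {ι : Type*} (w g : Ω → ℝ) (Q : Finset ι) (u : ι → Ω → ℝ) :
    ∑ ω, w ω * g ω * (∑ x ∈ Q, u x ω) = ∑ x ∈ Q, ∑ ω, w ω * g ω * u x ω := by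
  simp only [Finset.mul_sum]
  exact Finset.sum_comm

variable {w : Ω → ℝ} {t : V → Ω → ℝ} {G : V → V → ℝ} {Λ : Finset V} {c : V → ℝ}
  {Mc : Ω → ℝ} {Rs : Finset V → ℝ}
  (hw : ∀ ω, 0 < w ω) (hG : ∀ x y, G x y = ∑ ω, w ω * t x ω * t y ω)
  (hflip : ∀ x ∈ Λ, ∃ ω ω', t x ω ≠ t x ω' ∧ ∀ y, y ≠ x → t y ω = t y ω')
  (hc : ∀ y, c y = ∑ x ∈ Λ, G x y) (hMc : ∀ ω, Mc ω = ∑ x ∈ Λ, t x ω)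
  (hRs : ∀ P : Finset V, Rs P = (∑ x ∈ Λ, ∑ y ∈ Λ, G x y) -
      ∑ a : ↥P, ∑ b : ↥P, c a * (Matrix.of fun a b : ↥P => G a b)⁻¹ a b * c b)

include hw hG hflip in
/-- The Gram (covariance) matrix `(G(a,b))_{a,b ∈ P}` is nonsingular for `P ⊆ Λ`: its quadratic
form is `Σ w (Σ_a v_a t_a)²`, which vanishes only if `Σ_a v_a t_a ≡ 0` (all `w > 0`), and a
single-site modification of a pattern rules this out unless `v = 0` (copy of the private lemma of
`…LinEffLeOne`). [folklore] -/
private theorem isUnit_det_covP {P : Finset V} (hP : P ⊆ Λ) :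
    IsUnit (Matrix.of fun a b : ↥P => G a b).det := by
  set GP : Matrix ↥P ↥P ℝ := Matrix.of fun a b : ↥P => G a b with hGP
  rw [← Matrix.isUnit_iff_isUnit_det, ← Matrix.mulVec_injective_iff_isUnit]
  intro v v' hvv'
  rw [← sub_eq_zero]
  set u : ↥P → ℝ := v - v' with hu
  have hu0 : GP *ᵥ u = 0 := by rw [hu, Matrix.mulVec_sub, hvv', sub_self]
  set f : Ω → ℝ := fun ω => ∑ a : ↥P, u a * t a ω with hf
  -- the quadratic form of `GP` at `u` is the second moment of `f`, hence `f ≡ 0`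
  have hrow : ∀ b : ↥P, ∑ ω, w ω * f ω * t b ω = (GP *ᵥ u) b := fun b => by
    calc ∑ ω, w ω * f ω * t b ω = ∑ ω, w ω * t b ω * ∑ a : ↥P, u a * t a ω :=
          Finset.sum_congr rfl fun ω _ => by simp only [hf]; ring
      _ = ∑ a : ↥P, u a * ∑ ω, w ω * t b ω * t a ω :=
          wsum_mul_lin w (t b) Finset.univ u fun a : ↥P => t a
      _ = (GP *ᵥ u) b := by
          rw [Matrix.mulVec_apply_eq_sum]
          exact Finset.sum_congr rfl fun a _ => by rw [hGP, Matrix.of_apply, hG]; ring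
  have hz : ∑ ω, w ω * f ω ^ 2 = 0 := by
    calc ∑ ω, w ω * f ω ^ 2 = ∑ ω, w ω * f ω * ∑ b : ↥P, u b * t b ω :=
          Finset.sum_congr rfl fun ω _ => by simp only [hf]; ring
      _ = ∑ b : ↥P, u b * ∑ ω, w ω * f ω * t b ω :=
          wsum_mul_lin w f Finset.univ u fun b : ↥P => t b
      _ = 0 := by simp [hrow, hu0]
  have hf0 : ∀ ω, f ω = 0 := fun ω => by
    have h := (Finset.sum_eq_zero_iff_of_nonneg fun ω _ =>
      mul_nonneg (hw ω).le (sq_nonneg (f ω))).1 hz ω (Finset.mem_univ ω)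
    exact (pow_eq_zero_iff two_ne_zero).1 ((mul_eq_zero.1 h).resolve_left (hw ω).ne')
  refine funext fun a => Classical.byContradiction fun hua => ?_
  obtain ⟨ω, ω', hx, hy⟩ := hflip a (hP a.2)
  have hdiff : f ω - f ω' = u a * (t a ω - t a ω') := by
    simp only [hf]
    rw [← Finset.sum_sub_distrib, Finset.sum_eq_single a]
    · ring
    · exact fun b _ hb => by rw [hy b (fun h => hb (Subtype.ext h)), sub_self]
    · exact fun h => absurd (Finset.mem_univ a) h
  rw [hf0 ω, hf0 ω', sub_self] at hdiff
  exact mul_ne_zero hua (sub_ne_zero.2 hx) hdiff.symm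

include hw hG hflip hc hMc hRs in
/-- **Least squares** for `M = Σ_{x ∈ Λ} t_x` on the observables `t_P`, `P ⊆ Λ`: the residual
`R = M − β*·t_P` with `β* = G_{PP}⁻¹ c_P` satisfies the normal equations `Σ w R t_y = 0`
(`y ∈ P`) and `Σ w R M = Σ w R² = Rs P = Var M − cᵀ G_{PP}⁻¹ c` (copy of the private lemma of
`…LinEffLeOne`). [folklore] -/
private theorem residual {P : Finset V} (hP : P ⊆ Λ) :
    ∃ (β : V → ℝ) (R : Ω → ℝ), (∀ ω, R ω = Mc ω - ∑ x ∈ P, β x * t x ω) ∧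
      (∀ y ∈ P, ∑ ω, w ω * R ω * t y ω = 0) ∧
      ∑ ω, w ω * R ω * Mc ω = Rs P ∧ ∑ ω, w ω * R ω ^ 2 = Rs P := by
  set β' : ↥P → ℝ := (Matrix.of fun a b : ↥P => G a b)⁻¹ *ᵥ fun a => c a with hβ'
  -- normal equations in matrix form: `G_{PP} β* = c_P`
  have hne : ∀ y (hy : y ∈ P), ∑ a : ↥P, G y a * β' a = c y := fun y hy => by
    have h : ((Matrix.of fun a b : ↥P => G a b) *ᵥ β') ⟨y, hy⟩ = c y := by
      rw [hβ', Matrix.mulVec_mulVec, Matrix.mul_nonsing_inv _ (isUnit_det_covP hw hG hflip hP),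
        Matrix.one_mulVec]
    simpa only [Matrix.mulVec_apply_eq_sum, Matrix.of_apply] using h
  set βV : V → ℝ := fun x => if hx : x ∈ P then β' ⟨x, hx⟩ else 0 with hβV
  set R : Ω → ℝ := fun ω => Mc ω - ∑ x ∈ P, βV x * t x ω with hR
  -- moments of `M`, of `β*·t_P` and of `R` against an observable
  have hMt : ∀ y, ∑ ω, w ω * Mc ω * t y ω = c y := fun y => by
    calc ∑ ω, w ω * Mc ω * t y ω = ∑ ω, w ω * t y ω * ∑ x ∈ Λ, t x ω :=
          Finset.sum_congr rfl fun ω _ => by rw [hMc]; ring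
      _ = c y := by
          rw [wsum_mul_sum, hc]
          refine Finset.sum_congr rfl fun x _ => ?_
          rw [hG]; exact Finset.sum_congr rfl fun ω _ => by ring
  have hℓg : ∀ g : Ω → ℝ, ∑ ω, w ω * g ω * (∑ x ∈ P, βV x * t x ω) =
      ∑ a : ↥P, β' a * ∑ ω, w ω * g ω * t a ω := fun g => by
    have hℓ : ∀ ω, ∑ x ∈ P, βV x * t x ω = ∑ a : ↥P, β' a * t a ω := fun ω => by
      rw [← Finset.sum_coe_sort P (fun x => βV x * t x ω)]
      exact Finset.sum_congr rfl fun a _ => by simp [hβV]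
    simp only [hℓ]
    exact wsum_mul_lin w g Finset.univ β' fun a : ↥P => t a
  have hsplit : ∀ g : Ω → ℝ, ∑ ω, w ω * R ω * g ω =
      ∑ ω, w ω * Mc ω * g ω - ∑ ω, w ω * g ω * (∑ x ∈ P, βV x * t x ω) := fun g => by
    rw [← Finset.sum_sub_distrib]; exact Finset.sum_congr rfl fun ω _ => by rw [hR]; ring
  have h0 : ∀ y ∈ P, ∑ ω, w ω * R ω * t y ω = 0 := fun y hy => by
    rw [hsplit, hMt, hℓg, ← hne y hy, ← Finset.sum_sub_distrib]
    exact Finset.sum_eq_zero fun a _ => by rw [← hG]; ring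
  have hMM : ∑ ω, w ω * Mc ω * Mc ω = ∑ x ∈ Λ, ∑ y ∈ Λ, G x y := by
    calc ∑ ω, w ω * Mc ω * Mc ω = ∑ ω, w ω * Mc ω * ∑ y ∈ Λ, t y ω :=
          Finset.sum_congr rfl fun ω _ => by rw [← hMc]
      _ = ∑ y ∈ Λ, c y := by rw [wsum_mul_sum]; exact Finset.sum_congr rfl fun y _ => hMt y
      _ = ∑ x ∈ Λ, ∑ y ∈ Λ, G x y := by
          rw [Finset.sum_comm]; exact Finset.sum_congr rfl fun y _ => hc y
  have hM : ∑ ω, w ω * R ω * Mc ω = Rs P := by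
    rw [hsplit, hℓg, hMM, hRs P]
    congr 1
    refine Finset.sum_congr rfl fun a _ => ?_
    rw [hMt, hβ', Matrix.mulVec_apply_eq_sum, Finset.sum_mul]
    exact Finset.sum_congr rfl fun b _ => by ring
  have hRR : ∑ ω, w ω * R ω ^ 2 = Rs P := by
    calc ∑ ω, w ω * R ω ^ 2
          = ∑ ω, w ω * R ω * Mc ω - ∑ ω, w ω * R ω * ∑ x ∈ P, βV x * t x ω := by
          rw [← Finset.sum_sub_distrib]; exact Finset.sum_congr rfl fun ω _ => by rw [hR]; ring
      _ = Rs P := by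
          rw [hM, wsum_mul_lin w R P βV t, Finset.sum_eq_zero fun x hx => ?_, sub_zero]
          rw [h0 x hx, mul_zero]
  exact ⟨βV, R, fun ω => rfl, h0, hM, hRR⟩

include hw hG hflip hc hMc hRs in
/-- **Variational characterisation of the linear residual**: `0 ≤ Rs Q ≤ Σ w (M − γ·t_Q)²` for
every coefficient vector `γ`, `Q ⊆ Λ` (Pythagoras with the normal equations; copy of the private
lemma of `…LinEffLeOne`). [folklore] -/
private theorem residual_le {Q : Finset V} (hQ : Q ⊆ Λ) (γ : V → ℝ) :
    0 ≤ Rs Q ∧ Rs Q ≤ ∑ ω, w ω * (Mc ω - ∑ x ∈ Q, γ x * t x ω) ^ 2 := by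
  obtain ⟨β, R, -, h0, hM, hR⟩ := residual hw hG hflip hc hMc hRs hQ
  set F : Ω → ℝ := fun ω => Mc ω - ∑ x ∈ Q, γ x * t x ω with hF
  have hRF : ∑ ω, w ω * R ω * F ω = Rs Q := by
    calc ∑ ω, w ω * R ω * F ω
          = ∑ ω, w ω * R ω * Mc ω - ∑ ω, w ω * R ω * ∑ x ∈ Q, γ x * t x ω := by
          rw [← Finset.sum_sub_distrib]; exact Finset.sum_congr rfl fun ω _ => by rw [hF]; ring
      _ = Rs Q := by
          rw [hM, wsum_mul_lin w R Q γ t, Finset.sum_eq_zero fun x hx => ?_, sub_zero]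
          rw [h0 x hx, mul_zero]
  have hpos : 0 ≤ ∑ ω, w ω * (F ω - R ω) ^ 2 :=
    Finset.sum_nonneg fun ω _ => mul_nonneg (hw ω).le (sq_nonneg _)
  have hexp : ∑ ω, w ω * (F ω - R ω) ^ 2 =
      ∑ ω, w ω * F ω ^ 2 - 2 * ∑ ω, w ω * R ω * F ω + ∑ ω, w ω * R ω ^ 2 := by
    rw [Finset.mul_sum, ← Finset.sum_sub_distrib, ← Finset.sum_add_distrib]
    exact Finset.sum_congr rfl fun ω _ => by ring
  rw [hRF, hR] at hexp
  exact ⟨hR ▸ Finset.sum_nonneg fun ω _ => mul_nonneg (hw ω).le (sq_nonneg _), by linarith⟩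

/-! ### Monotonicity and positivity of the linear residual, and of its subset averages -/

include hw hG hflip hc hMc hRs in
/-- **Adding a pin never increases the linear residual**: `Rs (P ∪ {z}) ≤ Rs P` for `P ⊆ Λ`,
`z ∈ Λ ∖ P` — test the variational bound for `P ∪ {z}` with the optimal coefficients of `P`
extended by `γ_z = 0`, whose trial residual is `R_P` itself. [folklore] -/
private theorem residual_insert_le {P : Finset V} (hP : P ⊆ Λ) {z : V} (hz : z ∈ Λ \ P) :
    Rs (insert z P) ≤ Rs P := by
  obtain ⟨hzΛ, hzP⟩ := Finset.mem_sdiff.1 hz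
  obtain ⟨β, R, hRdef, -, -, hR⟩ := residual hw hG hflip hc hMc hRs hP
  have hF : ∀ ω, Mc ω - ∑ x ∈ insert z P, Function.update β z 0 x * t x ω = R ω := fun ω => by
    have hP' : ∑ x ∈ P, Function.update β z 0 x * t x ω = ∑ x ∈ P, β x * t x ω :=
      Finset.sum_congr rfl fun x hx => by
        rw [Function.update_of_ne (ne_of_mem_of_not_mem hx hzP)]
    rw [Finset.sum_insert hzP, Function.update_self, hP', hRdef]
    ring
  have hvar := (residual_le hw hG hflip hc hMc hRs (Finset.insert_subset hzΛ hP)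
    (Function.update β z 0)).2
  have hsum : ∑ ω, w ω * (Mc ω - ∑ x ∈ insert z P, Function.update β z 0 x * t x ω) ^ 2 =
      ∑ ω, w ω * R ω ^ 2 := Finset.sum_congr rfl fun ω _ => by rw [hF ω]
  rwa [hsum, hR] at hvar

include hw hG hflip hc hMc hRs in
/-- **The linear residual is positive while a site is free**: for `P ⊆ Λ` and `z ∈ Λ ∖ P`,
`0 < Rs P` — the two patterns of the one-site flip at `z` are told apart by the residual
(`R_P ω − R_P ω' = t_z ω − t_z ω' ≠ 0`), so `R_P ≢ 0` and `Rs P = Σ w R_P² > 0` since all the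
weights are positive. [folklore] -/
private theorem residual_pos {P : Finset V} (hP : P ⊆ Λ) {z : V} (hz : z ∈ Λ \ P) :
    0 < Rs P := by
  obtain ⟨hzΛ, hzP⟩ := Finset.mem_sdiff.1 hz
  obtain ⟨β, R, hRdef, -, -, hR⟩ := residual hw hG hflip hc hMc hRs hP
  obtain ⟨ω, ω', hx, hy⟩ := hflip z hzΛ
  -- the residual separates the two patterns of the flip at the free site `z`
  have h1 : Mc ω - Mc ω' = t z ω - t z ω' := by
    rw [hMc ω, hMc ω', ← Finset.sum_sub_distrib, Finset.sum_eq_single z]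
    · exact fun x _ hxz => by rw [hy x hxz, sub_self]
    · exact fun h => absurd hzΛ h
  have h2 : ∑ x ∈ P, β x * t x ω - ∑ x ∈ P, β x * t x ω' = 0 := by
    rw [← Finset.sum_sub_distrib]
    exact Finset.sum_eq_zero fun x hxP => by
      rw [hy x (ne_of_mem_of_not_mem hxP hzP), sub_self]
  have hdiff : R ω - R ω' = t z ω - t z ω' := by rw [hRdef ω, hRdef ω']; linarith
  have hne : R ω ≠ 0 ∨ R ω' ≠ 0 := by
    by_contra h
    push Not at h
    rw [h.1, h.2, sub_self] at hdiff
    exact hx (sub_eq_zero.1 hdiff.symm)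
  -- one nonzero value of `R_P` makes the weighted second moment positive
  have key : ∀ ω₀, R ω₀ ≠ 0 → 0 < Rs P := fun ω₀ h₀ => by
    rw [← hR]
    calc (0 : ℝ) < w ω₀ * R ω₀ ^ 2 := mul_pos (hw ω₀) (sq_pos_of_ne_zero h₀)
      _ ≤ ∑ ω, w ω * R ω ^ 2 :=
          Finset.single_le_sum (fun ω _ => mul_nonneg (hw ω).le (sq_nonneg (R ω)))
            (Finset.mem_univ ω₀)
  rcases hne with h | h
  exacts [key ω h, key ω' h]

include hw hG hflip hc hMc hRs in
/-- **The linear Riccati flow is positive and non-increasing**: for `j < n = |Λ|` and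
`v_j = (n choose j)⁻¹ Σ_{P ⊆ Λ, |P| = j} Rs P`, `0 < v_j` and `v_{j+1} ≤ v_j`. Positivity:
every `j`-subset misses a site (`residual_pos`). Monotonicity: average `residual_insert_le` over
the pairs `(P, z)`, `|P| = j`, `z ∈ Λ ∖ P`, by double counting
(`sum_powersetCard_sum_sdiff_insert`) and Pascal's rule `(j+1)·C(n,j+1) = (n−j)·C(n,j)`
(Montanari 2008; Raghavendra–Tan 2012, Lemma 4.3, the averaging step). [folklore] -/
private theorem flow_pos_antitone {j : ℕ} (hj : j < #Λ) :
    0 < (∑ P ∈ Λ.powersetCard j, Rs P) / ((#Λ).choose j : ℝ) ∧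
      (∑ Q ∈ Λ.powersetCard (j + 1), Rs Q) / ((#Λ).choose (j + 1) : ℝ) ≤
        (∑ P ∈ Λ.powersetCard j, Rs P) / ((#Λ).choose j : ℝ) := by
  set n := #Λ with hn
  set A := ∑ P ∈ Λ.powersetCard j, Rs P with hA
  set A' := ∑ Q ∈ Λ.powersetCard (j + 1), Rs Q with hA'
  set Cj : ℝ := (n.choose j : ℝ) with hCj
  set Cj' : ℝ := (n.choose (j + 1) : ℝ) with hCj'
  set m : ℝ := (n : ℝ) - j with hm
  have hCpos : 0 < Cj := by rw [hCj]; exact_mod_cast Nat.choose_pos hj.le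
  have hC'pos : 0 < Cj' := by rw [hCj']; exact_mod_cast Nat.choose_pos hj
  have hpascal : ((j : ℝ) + 1) * Cj' = m * Cj := by
    have h := Nat.choose_succ_right_eq n j
    have hcast : ((n - j : ℕ) : ℝ) = (n : ℝ) - j := Nat.cast_sub hj.le
    rw [hCj', hCj, hm, ← hcast]
    exact_mod_cast (by rw [mul_comm] at h; linarith [h] :
      (j + 1) * n.choose (j + 1) = (n - j) * n.choose j)
  have hcardT : ∀ P ∈ Λ.powersetCard j, (#(Λ \ P) : ℝ) = m := fun P hP => by
    obtain ⟨hPΛ, hPc⟩ := Finset.mem_powersetCard.1 hP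
    rw [Finset.card_sdiff_of_subset hPΛ, hPc, Nat.cast_sub hj.le, hm]
  have hfree : ∀ P ∈ Λ.powersetCard j, (Λ \ P).Nonempty := fun P hP => by
    obtain ⟨hPΛ, hPc⟩ := Finset.mem_powersetCard.1 hP
    rw [← Finset.card_pos, Finset.card_sdiff_of_subset hPΛ, hPc]; omega
  -- positivity: one `j`-subset exists, and its residual is positive
  have hApos : 0 < A := by
    obtain ⟨P₀, hP₀⟩ := (Finset.powersetCard_nonempty (s := Λ) (n := j)).2 hj.le
    obtain ⟨z, hz⟩ := hfree P₀ hP₀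
    calc 0 < Rs P₀ := residual_pos hw hG hflip hc hMc hRs (Finset.mem_powersetCard.1 hP₀).1 hz
      _ ≤ A := Finset.single_le_sum (fun P hP => (residual_le hw hG hflip hc hMc hRs
          (Finset.mem_powersetCard.1 hP).1 fun _ => 0).1) hP₀
  refine ⟨div_pos hApos hCpos, ?_⟩
  -- monotonicity: average `Rs (insert z P) ≤ Rs P` over the pairs `(P, z)`
  have hsum : ((j : ℝ) + 1) * A' ≤ m * A := by
    calc ((j : ℝ) + 1) * A' = ∑ P ∈ Λ.powersetCard j, ∑ z ∈ Λ \ P, Rs (insert z P) :=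
          (sum_powersetCard_sum_sdiff_insert Λ j Rs).symm
      _ ≤ ∑ P ∈ Λ.powersetCard j, ∑ z ∈ Λ \ P, Rs P :=
          Finset.sum_le_sum fun P hP => Finset.sum_le_sum fun z hz =>
            residual_insert_le hw hG hflip hc hMc hRs (Finset.mem_powersetCard.1 hP).1 hz
      _ = m * A := by
          rw [hA, Finset.mul_sum]
          refine Finset.sum_congr rfl fun P hP => ?_
          rw [Finset.sum_const, nsmul_eq_mul, hcardT P hP]
  rw [div_le_div_iff₀ hC'pos hCpos]
  have h1 : ((j : ℝ) + 1) * (A' * Cj) ≤ ((j : ℝ) + 1) * (A * Cj') := by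
    calc ((j : ℝ) + 1) * (A' * Cj) = ((j : ℝ) + 1) * A' * Cj := by ring
      _ ≤ m * A * Cj := mul_le_mul_of_nonneg_right hsum hCpos.le
      _ = A * (m * Cj) := by ring
      _ = ((j : ℝ) + 1) * (A * Cj') := by rw [← hpascal]; ring
  exact le_of_mul_le_mul_left h1 (by positivity)

end Abstract

/-! ### The Ising instantiation -/

/-- **Bookkeeping stub `stub_linVarAntitone`** (registered signature, verbatim): the linear
Riccati flow `v_j = linVar L j` of the critical `+` box is positive and non-increasing,
`0 < v_j` and `v_{j+1} ≤ v_j` for `j < |Λ_L|` (`flow_pos_antitone` with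
`t_x = σ_x − ⟨σ_x⟩⁺_L`, `w = w⁺_L/Z`, `G = cov L`; Montanari 2008; Raghavendra–Tan 2012,
Lemma 4.3, for Schur complements of the Ising covariance). [folklore] -/
theorem stub_linVarAntitone :
    ∀ (L j : ℕ), j < (box 3 L).card → 0 < linVar L j ∧ linVar L (j + 1) ≤ linVar L j := by
  intro L j hj
  -- the plus state as a finite probability vector with positive entries
  have hZpos : 0 < isingPartitionFunction (zdGraph 3) (box 3 L) (criticalBeta 3) 0 .plus :=
    isingPartitionFunction_pos _ _ _ _ _
  have hwpos : ∀ τ, 0 < plusProb L τ := fun τ =>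
    div_pos (isingWeight_pos (zdGraph 3) (box 3 L) (criticalBeta 3) 0 .plus τ) hZpos
  have hw1 : ∑ τ, plusProb L τ = 1 := by
    unfold plusProb; rw [← Finset.sum_div, div_eq_one_iff_eq hZpos.ne']; rfl
  have hplusE : ∀ {f : SpinConfig (Site 3) → ℝ}, Measurable f →
      plusE L f = ∑ τ, plusProb L τ * f (glue (box 3 L) τ .plus) := by
    intro f hf
    have h : plusE L f = (∑ τ, isingWeight (zdGraph 3) (box 3 L) (criticalBeta 3) 0 .plus τ *
        f (glue (box 3 L) τ .plus)) /
          isingPartitionFunction (zdGraph 3) (box 3 L) (criticalBeta 3) 0 .plus :=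
      integral_isingMeasure (zdGraph 3) (box 3 L) (criticalBeta 3) 0 .plus hf
    rw [h, Finset.sum_div]
    exact Finset.sum_congr rfl fun τ _ => by unfold plusProb; ring
  -- centred spins `t_x = σ_x − ⟨σ_x⟩⁺`
  set s : Site 3 → (↥(box 3 L) → ℤˣ) → ℝ := fun x τ => spinAt x (glue (box 3 L) τ .plus) with hs
  set t : Site 3 → (↥(box 3 L) → ℤˣ) → ℝ := fun x τ => s x τ - plusE L (spinAt x) with ht
  have hμ : ∀ x, ∑ τ, plusProb L τ * s x τ = plusE L (spinAt x) := fun x =>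
    (hplusE (measurable_spinAt x)).symm
  have hG : ∀ x y, cov L x y = ∑ τ, plusProb L τ * t x τ * t y τ := by
    intro x y
    have h1 : plusE L (fun σ => spinAt x σ * spinAt y σ) = ∑ τ, plusProb L τ * (s x τ * s y τ) :=
      hplusE ((measurable_spinAt x).fun_mul (measurable_spinAt y))
    have h2 : ∀ τ, plusProb L τ * t x τ * t y τ = plusProb L τ * (s x τ * s y τ)
        - plusE L (spinAt y) * (plusProb L τ * s x τ) - plusE L (spinAt x) * (plusProb L τ * s y τ)
        + plusE L (spinAt x) * plusE L (spinAt y) * plusProb L τ := fun τ => by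
      simp only [ht]; ring
    unfold cov
    rw [h1, Finset.sum_congr rfl fun τ _ => h2 τ, Finset.sum_add_distrib, Finset.sum_sub_distrib,
      Finset.sum_sub_distrib, ← Finset.mul_sum, ← Finset.mul_sum, ← Finset.mul_sum, hμ, hμ, hw1]
    ring
  -- flipping one spin of the all-plus pattern changes exactly one centred spin
  have hflip : ∀ x ∈ box 3 L, ∃ ω ω' : ↥(box 3 L) → ℤˣ,
      t x ω ≠ t x ω' ∧ ∀ y, y ≠ x → t y ω = t y ω' := by
    intro x hx
    refine ⟨fun _ => 1, Function.update (fun _ => 1) ⟨x, hx⟩ (-1), ?_, fun y hy => ?_⟩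
    · simp only [ht, hs, spinAt, glue_apply_of_mem _ _ _ hx, Function.update_self]
      norm_num
    · by_cases hyΛ : y ∈ box 3 L
      · have hne : (⟨y, hyΛ⟩ : ↥(box 3 L)) ≠ ⟨x, hx⟩ := fun h => hy (congrArg Subtype.val h)
        simp only [ht, hs, spinAt, glue_apply_of_mem _ _ _ hyΛ, Function.update_of_ne hne]
      · simp only [ht, hs, spinAt, glue_apply_of_notMem _ _ _ hyΛ]
  -- the abstract flow statement for the linear residual
  unfold linVar
  exact flow_pos_antitone (w := plusProb L) (t := t) (G := cov L) (Λ := box 3 L)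
    (c := covTot L) (Mc := fun τ => ∑ x ∈ box 3 L, t x τ) (Rs := linResidual L)
    hwpos hG hflip (fun _ => rfl) (fun _ => rfl) (fun _ => rfl) hj

end Summit.CriticalPhenomena.Ising3DConformalLimit.PlantedPinningGaussianPinningSaturation

end
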